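import Mathlib
import Summits.MatrixMultiplication.MatrixMultiplication.Theorems.BorderHalfDimensionDesigns.Negative.CountingBarrier

/-!
# `GLnSeparatingDesigns.BorderHalfDimensionDesigns` (stmt-MatrixMultiplication-18360) — Negative lane, II:
# the two natural strengthenings of the crux are false (finite counting, no appeal to `ω`)

* `not_superHalfDimensionDesigns` — sizes `q^(n²/2 + c)` with degree `q^(1+δ)` for all `δ > 0`: impossible.
* `not_halfDimensionDesigns_sublinearDegree` — sizes `q^(n²/2 − εn)` with degree `q^(1−c)`: impossible.
BCGPU 2024 (arXiv:2410.14905, p. 7 and the remark after Cor. 2.8, p. 15) state both via "`ω < 2` is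
absurd"; here they follow from `|X||Z| ≤ (s+1)^(n²)` alone.  The crux sits exactly on the counting
boundary `2·(n²/2 − εn) ≤ (1+δ)·n²`.
-/

namespace Summit.MatrixMultiplication.MatrixMultiplication.Theorems

open scoped BigOperators Matrix
open Finset

namespace BorderHalfDimensionDesignsNeg

/-! ## (c) Natural strengthenings refuted (finite counting; no appeal to `ω`) -/

/-- **Sizes beyond half dimension are impossible.**  For every fixed `n` and `c > 0` there is no
family of TPP designs of sizes `≥ q^(n²/2 + c)` with `η`-separators of degree `≤ q^(1+δ)` for every
`δ > 0`: the crux's size exponent `n²/2` is the counting ceiling `(|X||Z| ≤ (s+1)^(n²))`, and its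
`−εn` is all the slack there is (BCGPU 2024, remark after Cor. 2.8, p. 15 — there via "`ω < 2` is
absurd"; here unconditionally). [folklore] -/
theorem not_superHalfDimensionDesigns (n : ℕ) {c : ℝ} (hc : 0 < c) :
    ¬ (∀ δ : ℝ, 0 < δ → ∀ q₀ : ℕ, ∃ q : ℕ, q₀ ≤ q ∧ ∀ η : ℝ, 0 < η →
        ∃ X Y Z : Finset (Matrix.GeneralLinearGroup (Fin n) ℂ), (∀ x ∈ X, ∀ x' ∈ X, ∀ y ∈ Y, ∀ y' ∈ Y, ∀ z ∈ Z, ∀ z' ∈ Z,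
            x * y⁻¹ * y' * z⁻¹ = x' * z'⁻¹ → x = x' ∧ y = y' ∧ z = z') ∧
          (q : ℝ) ^ ((n : ℝ) ^ 2 / 2 + c) ≤ (X.card : ℝ) ∧
          (q : ℝ) ^ ((n : ℝ) ^ 2 / 2 + c) ≤ (Y.card : ℝ) ∧
          (q : ℝ) ^ ((n : ℝ) ^ 2 / 2 + c) ≤ (Z.card : ℝ) ∧
          ∀ x₀ ∈ X, ∀ z₀ ∈ Z, ∃ p : MvPolynomial (Fin n × Fin n) ℂ,
            (p.totalDegree : ℝ) ≤ (q : ℝ) ^ (1 + δ) ∧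
            ∀ x ∈ X, ∀ y ∈ Y, ∀ y' ∈ Y, ∀ z ∈ Z,
              ((x = x₀ ∧ y = y' ∧ z = z₀) → ‖MvPolynomial.eval (pt x y y' z) p - 1‖ ≤ η) ∧
              (¬ (x = x₀ ∧ y = y' ∧ z = z₀) → ‖MvPolynomial.eval (pt x y y' z) p‖ ≤ η)) := by
  intro H
  have hn2 : (0 : ℝ) ≤ (n : ℝ) ^ 2 := by positivity
  have hδ : 0 < c / ((n : ℝ) ^ 2 + 1) := by positivity
  refine no_designs_beyond_counting n (a := (n : ℝ) ^ 2 / 2 + c) (b := 1 + c / ((n : ℝ) ^ 2 + 1))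
    (by positivity) ?_ ?_
  · have h1 : c / ((n : ℝ) ^ 2 + 1) * (n : ℝ) ^ 2 ≤ c := by
      rw [div_mul_eq_mul_div, div_le_iff₀ (by positivity)]
      nlinarith
    nlinarith
  · intro q₀
    obtain ⟨q, hq, Hq⟩ := H _ hδ q₀
    refine ⟨q, hq, fun η hη => ?_⟩
    obtain ⟨X, Y, Z, -, hX, hY, hZ, hsep⟩ := Hq η hη
    exact ⟨X, Y, Z, hX, hY, hZ, hsep⟩

/-- **Sub-linear separating degree is impossible at half dimension.**  For every `c > 0`, the crux
with degree budget `q^(1−c)` in place of `q^(1+δ)` is false: sizes `q^(n²/2 − εn)` need degree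
`≥ q^(1 − 2ε/n − o(1))` by counting alone (BCGPU 2024 p. 7 / p. 15: "unconditionally at such sizes one
cannot have separating polynomials of degree `q^(1−c)`" — printed via `ω < 2`; here directly).  So the
degree exponent `1 + o(1)` of the crux cannot be lowered: the statement sits exactly on the counting
boundary. [folklore] -/
theorem not_halfDimensionDesigns_sublinearDegree {c : ℝ} (hc : 0 < c) :
    ¬ (∀ ε : ℝ, 0 < ε → ∃ n : ℕ, 3 ≤ n ∧ ∀ q₀ : ℕ, ∃ q : ℕ, q₀ ≤ q ∧ ∀ η : ℝ, 0 < η →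
        ∃ X Y Z : Finset (Matrix.GeneralLinearGroup (Fin n) ℂ), (∀ x ∈ X, ∀ x' ∈ X, ∀ y ∈ Y, ∀ y' ∈ Y, ∀ z ∈ Z, ∀ z' ∈ Z,
            x * y⁻¹ * y' * z⁻¹ = x' * z'⁻¹ → x = x' ∧ y = y' ∧ z = z') ∧
          (q : ℝ) ^ ((n : ℝ) ^ 2 / 2 - ε * n) ≤ (X.card : ℝ) ∧
          (q : ℝ) ^ ((n : ℝ) ^ 2 / 2 - ε * n) ≤ (Y.card : ℝ) ∧
          (q : ℝ) ^ ((n : ℝ) ^ 2 / 2 - ε * n) ≤ (Z.card : ℝ) ∧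
          ∀ x₀ ∈ X, ∀ z₀ ∈ Z, ∃ p : MvPolynomial (Fin n × Fin n) ℂ,
            (p.totalDegree : ℝ) ≤ (q : ℝ) ^ (1 - c) ∧
            ∀ x ∈ X, ∀ y ∈ Y, ∀ y' ∈ Y, ∀ z ∈ Z,
              ((x = x₀ ∧ y = y' ∧ z = z₀) → ‖MvPolynomial.eval (pt x y y' z) p - 1‖ ≤ η) ∧
              (¬ (x = x₀ ∧ y = y' ∧ z = z₀) → ‖MvPolynomial.eval (pt x y y' z) p‖ ≤ η)) := by
  intro H
  set c' : ℝ := min c (1 / 2) with hc'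
  have hc'pos : 0 < c' := lt_min hc (by norm_num)
  have hc'le : c' ≤ 1 / 2 := min_le_right _ _
  have hc'c : c' ≤ c := min_le_left _ _
  obtain ⟨n, hn3, Hn⟩ := H (c' / 4) (by positivity)
  have hn : (3 : ℝ) ≤ n := by exact_mod_cast hn3
  refine no_designs_beyond_counting n (a := (n : ℝ) ^ 2 / 2 - c' / 4 * n) (b := 1 - c')
    (by linarith) ?_ ?_
  · nlinarith [mul_pos hc'pos (by linarith : (0 : ℝ) < n)]
  · intro q₀
    obtain ⟨q, hq, Hq⟩ := Hn (max q₀ 1)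
    have hq1 : (1 : ℝ) ≤ q := by exact_mod_cast le_trans (le_max_right q₀ 1) hq
    refine ⟨q, le_trans (le_max_left _ _) hq, fun η hη => ?_⟩
    obtain ⟨X, Y, Z, -, hX, hY, hZ, hsep⟩ := Hq η hη
    refine ⟨X, Y, Z, hX, hY, hZ, fun x₀ hx₀ z₀ hz₀ => ?_⟩
    obtain ⟨p, hpdeg, hp⟩ := hsep x₀ hx₀ z₀ hz₀
    exact ⟨p, hpdeg.trans (Real.rpow_le_rpow_of_exponent_le hq1 (by linarith)), hp⟩


end BorderHalfDimensionDesignsNeg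

end Summit.MatrixMultiplication.MatrixMultiplication.Theorems
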